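import Summits.MatrixMultiplication.MatrixMultiplication.Theorems.GraphEquationsExponentDescentDefs

/-!
# GraphEquations — corank of the `C`-Jacobian and the fibre jet (THEOREM ED, part 1/4)

Decomp-mm node «GraphEquations» (lens 5); attacked crux `MultiplicityReduction` (route
GraphEquations, item stmt-MatrixMultiplication-27806), registered line
`Cruxes/MultiplicityReduction/Lines/birth.lean` («exponent ladder»).  Part of THEOREM ED
(`Theorems/GraphEquationsExponentDescent.lean` proves its middle stub `stub_exponentDescent` by
statement); paper lens-5 g94, Lean text g95–g101, first elaborated g122.

* S1  `EqSystem.rank_add_corank`, `corank_eq_finrank_ker`, `reducedAt_of_ker_eq_bot`,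
      `exists_leftInverse_of_reducedAt`, `span_tests_trim` (definition `EqSystem.corank` in `…Defs`);
* S2 (steps 1–4)  the fibre jet `Φ_x` (`fibreJet`, `…Defs`): `fibreJet_generator`,
      `map_fibreJet_graphIdeal`, `map_fibreJet_vanishingIdeal_pow` (`Φ_x(𝕀(W_n)^M) = 𝔪^M`),
      `homogeneousComponent_one_fibreJet` (linear parts = `C`-Jacobian rows).
-/

set_option linter.dupNamespace false

namespace Summit.MatrixMultiplication.MatrixMultiplication.Theorems.GraphEquations

open MvPolynomial
-- `Basis` below is `Module.Basis` (tree precedent `open Matrix Module`,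
-- GraphEquationsCorankUnmasking l.49).
open Module
open Literature.Computability.AlgebraicComplexity
open Literature.Computability.AlgebraicComplexity.ArithCircuit
open Literature.AlgebraicGeometry.Hironaka2017.EdgeAlgebra (isHomogeneous_aeval_linear
  homogeneousComponent_aeval_linear)
open Literature.AlgebraicGeometry.Resolution (homogeneousComponent_eq_zero_of_mem_pow_idealOfVars
  mem_pow_idealOfVars_of_isHomogeneous sub_sum_homogeneousComponent_mem_pow_idealOfVars)

variable {n : ℕ}

/-! ## S1: the corank of the `C`-Jacobian -/

namespace EqSystem

/-- `rank + corank = n²`. -/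
theorem rank_add_corank (E : EqSystem n) (x : GraphVars n → ℂ) :
    (E.jacobianC x).rank + E.corank x = n * n := by
  have h : (E.jacobianC x).rank ≤ n * n := by
    calc (E.jacobianC x).rank ≤ Fintype.card (Fin n × Fin n) := Matrix.rank_le_card_width _
      _ = n * n := by simp
  unfold corank
  omega

/-- `ReducedAt x ⟺ corank x = 0`. -/
theorem reducedAt_iff_corank_eq_zero (E : EqSystem n) (x : GraphVars n → ℂ) :
    E.ReducedAt x ↔ E.corank x = 0 := by
  have h := E.rank_add_corank x
  unfold ReducedAt
  constructor <;> intro h' <;> omega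

/-- **S1.**  The corank is the dimension of `K = ker J_C(E)(x) ≤ ℂ^{n×n}` (rank–nullity). -/
theorem corank_eq_finrank_ker (E : EqSystem n) (x : GraphVars n → ℂ) :
    E.corank x = Module.finrank ℂ (LinearMap.ker (E.jacobianC x).mulVecLin) := by
  have h := LinearMap.finrank_range_add_finrank_ker (E.jacobianC x).mulVecLin
  rw [Module.finrank_fintype_fun_eq_card, Fintype.card_prod, Fintype.card_fin] at h
  -- `Matrix.rank A = finrank (range A.mulVecLin)` is the definition (Mathlib Matrix/Rank.lean l.133).
  unfold corank Matrix.rank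
  omega

/-- Full `C`-rank from a trivial kernel (the direction used by S3). -/
theorem reducedAt_of_ker_eq_bot {E : EqSystem n} {x : GraphVars n → ℂ}
    (h : LinearMap.ker (E.jacobianC x).mulVecLin = ⊥) : E.ReducedAt x := by
  unfold ReducedAt Matrix.rank
  rw [LinearMap.finrank_range_of_inj (LinearMap.ker_eq_bot.mp h), Module.finrank_fintype_fun_eq_card,
    Fintype.card_prod, Fintype.card_fin]

/-- A numeric LEFT INVERSE of `J_C(E)(x)` at a reduced point (S4 (c1′)): `rank = n² = #columns`
⇒ `mulVecLin` injective ⇒ a linear left inverse, read back as a matrix. -/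
theorem exists_leftInverse_of_reducedAt {E : EqSystem n} {x : GraphVars n → ℂ} (hred : E.ReducedAt x) :
    ∃ P : Matrix (Fin n × Fin n) (Fin E.tests.length) ℂ, P * E.jacobianC x = 1 := by
  classical
  have hker : LinearMap.ker (E.jacobianC x).mulVecLin = ⊥ := by
    apply Submodule.finrank_eq_zero.mp
    have h := LinearMap.finrank_range_add_finrank_ker (E.jacobianC x).mulVecLin
    rw [Module.finrank_fintype_fun_eq_card, Fintype.card_prod, Fintype.card_fin] at h
    have hr : Module.finrank ℂ (LinearMap.range (E.jacobianC x).mulVecLin) = n * n := by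
      unfold ReducedAt Matrix.rank at hred; exact hred
    omega
  obtain ⟨G, hG⟩ := LinearMap.exists_leftInverse_of_injective _ hker
  refine ⟨LinearMap.toMatrix' G, ?_⟩
  -- `toMatrix' G * J = toMatrix' (G ∘ₗ toLin' J) = toMatrix' id = 1`
  -- (ToLin.lean: `LinearMap.toMatrix'_toLin'` l.401, `LinearMap.toMatrix'_comp` l.468,
  --  `Matrix.toLin'_apply'` l.387, `LinearMap.toMatrix'_id` l.428).
  rw [← LinearMap.toMatrix'_toLin' (E.jacobianC x), ← LinearMap.toMatrix'_comp, Matrix.toLin'_apply',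
    hG, LinearMap.toMatrix'_id]

/-- Trimming does not change the test ideal (junk tests are `0`, duplicates are duplicates). -/
theorem span_tests_trim (E : EqSystem n) :
    Ideal.span {p | ∃ j ∈ E.trim.tests, p = E.trim.testPoly j} =
      Ideal.span {p | ∃ j ∈ E.tests, p = E.testPoly j} := by
  apply le_antisymm
  · refine Ideal.span_mono ?_
    rintro _ ⟨j, hj, rfl⟩
    exact ⟨j, (mem_trim_tests.mp hj).1, rfl⟩
  · refine Ideal.span_le.mpr ?_
    rintro _ ⟨j, hj, rfl⟩
    by_cases hjc : j < E.cost
    · exact Ideal.subset_span ⟨j, mem_trim_tests.mpr ⟨hj, hjc⟩, rfl⟩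
    · rw [testPoly_eq_zero_of_le (not_lt.mp hjc)]
      exact Ideal.zero_mem _

end EqSystem

/-! ## S2, steps 1–4: the fibre jet `Φ_x : ℂ[A,B,C] → ℂ[u]`, `A,B ↦ A(x),B(x)`, `c_q ↦ u_q + c_q(x)` -/

/-- `Φ_x(a) = a(x)`, `Φ_x(b) = b(x)` on the matrix variables. -/
@[simp] theorem fibreJet_X_inl (x : GraphVars n → ℂ) (v : MatMulVars n) :
    fibreJet x (X (Sum.inl v)) = C (x (Sum.inl v)) := by
  simp [fibreJet]

/-- `Φ_x(c_q) = u_q + c_q(x)`. -/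
@[simp] theorem fibreJet_X_inr (x : GraphVars n → ℂ) (q : Fin n × Fin n) :
    fibreJet x (X (Sum.inr q)) = X q + C (x (Sum.inr q)) := by
  simp [fibreJet]

/-- `Φ_x` fixes constants. -/
@[simp] theorem fibreJet_C (x : GraphVars n → ℂ) (a : ℂ) : fibreJet x (C a) = C a := by
  simp [fibreJet]

/-- Step 2: on the graph, `Φ_x(f_q) = u_q`. -/
theorem fibreJet_generator {x : GraphVars n → ℂ} (hx : x ∈ mmGraph n) (q : Fin n × Fin n) :
    fibreJet x (generator n q) = X q := by
  obtain ⟨i, l⟩ := q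
  have hq : x (Sum.inr (i, l)) =
      ∑ k : Fin n, x (Sum.inl (Sum.inl (i, k))) * x (Sum.inl (Sum.inr (k, l))) := hx i l
  simp only [generator, map_sub, map_sum, map_mul, fibreJet_X_inl, fibreJet_X_inr]
  rw [hq, map_sum]
  simp only [map_mul, add_sub_cancel_right]

/-- Step 3: the constant term of the jet is the value at `x`: `Φ_x(t)(0) = t(x)`. -/
theorem constantCoeff_fibreJet (x : GraphVars n → ℂ) (t : MvPolynomial (GraphVars n) ℂ) :
    constantCoeff (fibreJet x t) = MvPolynomial.eval x t := by
  induction t using MvPolynomial.induction_on with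
  | C a => simp
  | add p q hp hq => simp only [map_add, hp, hq]
  | mul_X p v hp =>
    rcases v with v | q
    · simp [hp]
    · simp [hp]

/-- Step 3, `coeff 0` form (`constantCoeff_eq : ⇑constantCoeff = coeff 0` is `rfl`). -/
theorem coeff_zero_fibreJet (x : GraphVars n → ℂ) (t : MvPolynomial (GraphVars n) ℂ) :
    coeff 0 (fibreJet x t) = MvPolynomial.eval x t :=
  constantCoeff_fibreJet x t

/-- Step 2 for ideals: `Φ_x(I) = 𝔪 = (u_q)_q`, hence `Φ_x(𝕀(W_n)^M) = 𝔪^M` (L5 + `Ideal.map_pow`).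
(`graphIdeal n = Ideal.span (Set.range (generator n))`, OrderObstruction l.141;
`idealOfVars σ R = Ideal.span (Set.range X)`, Mathlib MvPolynomial/Ideal.lean l.68.) -/
theorem map_fibreJet_graphIdeal {x : GraphVars n → ℂ} (hx : x ∈ mmGraph n) :
    Ideal.map (fibreJet x) (graphIdeal n) = MvPolynomial.idealOfVars (Fin n × Fin n) ℂ := by
  have hcomp : (⇑(fibreJet x) ∘ generator n) = (X : Fin n × Fin n → MvPolynomial (Fin n × Fin n) ℂ) := by
    funext q
    simp only [Function.comp_apply, fibreJet_generator hx q]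
  show Ideal.map (fibreJet x) (Ideal.span (Set.range (generator n))) = Ideal.span (Set.range X)
  rw [Ideal.map_span, ← Set.range_comp, hcomp]

/-- (H1) component of a product with a HOMOGENEOUS left factor:
`[ψ ρ]_N = ψ · [ρ]_{N−e}` for `ψ` homogeneous of degree `e ≤ N`
(`ρ = Σ_j [ρ]_j`, `sum_homogeneousComponent`; `ψ [ρ]_j` is homogeneous of degree `e + j`,
`homogeneousComponent_of_mem`). -/
theorem homogeneousComponent_mul_of_isHomogeneous_left {σ : Type} {ψ ρ : MvPolynomial σ ℂ}
    {e N : ℕ} (hψ : ψ.IsHomogeneous e) (he : e ≤ N) :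
    homogeneousComponent N (ψ * ρ) = ψ * homogeneousComponent (N - e) ρ := by
  -- A CITATION with no new import.  The tree lemma
  -- `Literature.RingTheory.MvPolynomial.homogeneousComponent_mul_add_of_isHomogeneous`
  -- (Literature/RingTheory/MvPolynomial/HomogeneousHilbertFunction.lean l.141; `{Q} {q}
  -- (hQ : Q.IsHomogeneous q) (r) (t : ℕ) : homogeneousComponent (t + q) (Q * r) = Q *
  -- homogeneousComponent t r`, `Field K`, any `σ`) is the `(t + q)`-form and lies in the import
  -- closure (Prelims → Hironaka1970RationalNearPointCylinder l.2 → HomogeneousHilbertFunction).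
  -- (Same statement, `CommRing`, `(i + j)`-form: `Literature.AlgebraicGeometry.Resolution.
  -- homogeneousComponent_mul_of_isHomogeneous_left`, RegularLocalRingsNormal.lean l.96 — not cited,
  -- it would add an import edge.)  This declaration is kept only as the
  -- `N = (N − e) + e` re-indexing used at the two call sites
  -- (`homogeneousComponent_mul_of_isHomogeneous_right`, `jet_count`).
  -- `Nat.sub_add_cancel : m ≤ n → n - m + m = n` (core Nat/Basic l.991).
  have h := Literature.RingTheory.MvPolynomial.homogeneousComponent_mul_add_of_isHomogeneous
    hψ ρ (N - e)
  rwa [Nat.sub_add_cancel he] at h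

/-- `Φ_x(𝕀(W_n)^M) = 𝔪^M` (L5 + `map_fibreJet_graphIdeal`). -/
theorem map_fibreJet_vanishingIdeal_pow {x : GraphVars n → ℂ} (hx : x ∈ mmGraph n) (M : ℕ) :
    Ideal.map (fibreJet x) (MvPolynomial.vanishingIdeal ℂ (mmGraph n) ^ M) =
      MvPolynomial.idealOfVars (Fin n × Fin n) ℂ ^ M := by
  rw [Ideal.map_pow, vanishingIdeal_eq_graphIdeal, map_fibreJet_graphIdeal hx]

/-- Step 4 (linear part): for `t ∈ I`, the degree-one part of the jet is the `C`-gradient at `x`: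
`[Φ_x t]_1 = Σ_p (∂t/∂c_p)(x) · u_p`.  Proof through `t = Σ_q h_q f_q` (E-a: `∂f_q/∂c_p = [p = q]`),
both sides being `Σ_p h_p(x) u_p`; no general chain rule is needed. -/
theorem homogeneousComponent_one_fibreJet {x : GraphVars n → ℂ} (hx : x ∈ mmGraph n)
    {t : MvPolynomial (GraphVars n) ℂ} (ht : t ∈ graphIdeal n) :
    homogeneousComponent 1 (fibreJet x t) =
      ∑ p : Fin n × Fin n, C (MvPolynomial.eval x (MvPolynomial.pderiv (Sum.inr p) t)) * X p := by
  have ht' : t ∈ Ideal.span (Set.range (generator n)) := ht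
  obtain ⟨h, rfl⟩ := Ideal.mem_span_range_iff_exists_fun.1 ht'
  -- right-hand side: `(∂/∂c_p)(Σ_q h_q f_q)(x) = h_p(x)` (the computation `hR` of `taylor_mod_sq`)
  have hR : ∀ p : Fin n × Fin n,
      MvPolynomial.eval x (MvPolynomial.pderiv (Sum.inr p) (∑ q, h q * generator n q)) =
        MvPolynomial.eval x (h p) := by
    intro p
    rw [map_sum]
    -- as in Prelims `taylor_mod_sq`/`hR`, then evaluate: `f_q(x) = 0`
    -- (`eval_eq_zero_of_mem_graphIdeal (generator_mem_graphIdeal q) hx`, Derivations l.77).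
    simp only [Derivation.leibniz, smul_eq_mul, pderiv_inr_generator', mul_ite, mul_one, mul_zero,
      map_add, map_sum, map_mul, eval_eq_zero_of_mem_graphIdeal (generator_mem_graphIdeal _) hx,
      apply_ite (MvPolynomial.eval x), map_zero, Finset.sum_ite_eq, Finset.mem_univ,
      if_true, add_zero, mul_zero, zero_mul]
  simp_rw [hR]
  -- left-hand side: `Φ(Σ h_q f_q) = Σ Φ(h_q) u_q`, whose degree-one part is `Σ h_q(x) u_q`
  rw [map_sum (fibreJet x), map_sum (homogeneousComponent 1)]
  refine Finset.sum_congr rfl fun q _ => ?_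
  rw [map_mul, fibreJet_generator hx, mul_comm,
    homogeneousComponent_mul_of_isHomogeneous_left (isHomogeneous_X ℂ q) le_rfl, Nat.sub_self,
    homogeneousComponent_zero, coeff_zero_fibreJet, mul_comm]
end Summit.MatrixMultiplication.MatrixMultiplication.Theorems.GraphEquations
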